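import Summits.AtomisticToContinuum.Crystallization.Theorems.ExcessDecayLiouvilleLinearSupApplied
import Summits.AtomisticToContinuum.Crystallization.Theorems.ExcessDecayLiouvilleLinearTaylor

/-!
# Route `ExcessDecayLiouville`: the linear decay step (linear levels, X)

Linear half of the harmonic-replacement architecture for item `ExcessDecay` (stmt-AtomisticToContinuum-9334),
assembled: a finitely supported `h` whose operator rows on `dist · c₀ ≤ ρ_h` are a sublattice-constant field
`Gf`, balanced at the level-one radius `R₁ = 1280r' + 2388`, is on `S ∩ B_r(c₀)` within
`12 N² √Θ₂` of an affine-plus-shift field (`N ≥ (400/189)(r + 11/5)`, `r' ≥ max(2, 4N + 11)`,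
`ρ_h ≥ 2R₁ + 4`), with `Θ₂ = 64L⁴Γ/r'⁵ + (64L⁴/r'³ + 3216L⁴r'³) JΔ` as in
`ExcessDecayLiouvilleLinearSupApplied`; the slope `B` satisfies `‖B‖² ≤ 144 Θ₁`.

* `linear_decay` : the statement above.

All `[folklore]`; helper lemmas, nothing here closes an item.
-/

noncomputable section

namespace Summit.AtomisticToContinuum.Crystallization.Theorems.ExcessDecayLiouville

open scoped BigOperators Topology InnerProductSpace RealInnerProductSpace Classical
open Literature.MathematicalPhysics.StatisticalMechanics
open Summit.AtomisticToContinuum.Crystallization.Theorems.PhononStabilityNegative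

-- Local notation: the force-constant map `K(e)w = h(|e|²)w + 2⟪e,w⟫h′(|e|²)e`.
local notation3 "𝕂[" e "] " w:max =>
  (-((‖e‖ ^ 2)⁻¹) ^ 7 + ((‖e‖ ^ 2)⁻¹) ^ 4) • w + (2 * ⟪e, w⟫ * (7 * ((‖e‖ ^ 2)⁻¹) ^ 8 - 4 * ((‖e‖ ^ 2)⁻¹) ^ 5)) • e
set_option quotPrecheck false in
local notation "𝟙ᵇ[" x ", " c ", " R "]" => (if dist (x : EuclideanSpace ℝ (Fin 3)) c ≤ R then (1 : ℝ) else 0)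
-- the three forward generators of `Λ₀`
local notation "𝐮₁" => (triangularVec₁ 1 : EuclideanSpace ℝ (Fin 3))
local notation "𝐮₂" => (triangularVec₂ 1 : EuclideanSpace ℝ (Fin 3))
local notation "𝐰₃" => (layerNormal (2 * Real.sqrt (2 / 3)) : EuclideanSpace ℝ (Fin 3))
-- the constants of one level in mass form
local notation "Cₐ" => (19 * (1024 / ((23 / 25 : ℝ) ^ 3 * (23 / 25 : ℝ) ^ 3)) + 38 * (1024 / (23 / 25 : ℝ) ^ 3))
local notation "Cⱼ" => (9961472 : ℝ)

section

variable {t : Fin 2 → (EuclideanSpace ℝ (Fin 3))} {A : (EuclideanSpace ℝ (Fin 3)) →L[ℝ] (EuclideanSpace ℝ (Fin 3))}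
  {c₀ : EuclideanSpace ℝ (Fin 3)} {κ : ℝ}

set_option quotPrecheck false in
-- Local notation: the operator row `(L v)(p)`.
local notation "𝕃" v:max " @ " p:max =>
  tsum (fun q : Sites₀ t A => (if ((p : Sites₀ t A) : EuclideanSpace ℝ (Fin 3)) ≠ q then
    𝕂[((p : Sites₀ t A) : EuclideanSpace ℝ (Fin 3)) - q] (v ((p : Sites₀ t A) : EuclideanSpace ℝ (Fin 3)) - v q) else 0))
set_option quotPrecheck false in
-- local mass on the ball of radius `X` about the section centre `c₀`
local notation "𝐌[" f ", " X "]" =>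
  tsum (fun p : Sites₀ t A => ‖f (p : EuclideanSpace ℝ (Fin 3))‖ ^ 2 * 𝟙ᵇ[p, c₀, X])
set_option quotPrecheck false in
-- weighted far mass with floor `Y` about `c₀`
local notation "𝐉[" f ", " Y "]" =>
  tsum (fun q : Sites₀ t A => ‖f (q : EuclideanSpace ℝ (Fin 3))‖ ^ 2 * (max (dist (q : EuclideanSpace ℝ (Fin 3)) c₀) Y)⁻¹ ^ 8)
set_option quotPrecheck false in
-- lattice difference
local notation "Δ[" τ "] " f:max => (fun x : EuclideanSpace ℝ (Fin 3) => f (x + A τ) - f x)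
set_option quotPrecheck false in
-- the level constant `L = (4Cₐ + 24Cⱼ)/κ + 1`
local notation "𝐋" => ((4 * Cₐ + 24 * Cⱼ) / κ + 1)
set_option quotPrecheck false in
-- the level-one work term at radius `R₁`
local notation "𝐖[" Gf ", " h ", " R₁ "]" =>
  tsum (fun p : Sites₀ t A => (if (p : EuclideanSpace ℝ (Fin 3)) ∈ Sites₀ t A then
    max (min 1 ((R₁ + 2 + R₁ - dist (p : EuclideanSpace ℝ (Fin 3)) c₀) / R₁)) 0 else 0) ^ 2 *
      ⟪Gf (p : EuclideanSpace ℝ (Fin 3)), h (p : EuclideanSpace ℝ (Fin 3))⟫)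
set_option quotPrecheck false in
-- the gradient far mass
local notation "𝐉Δ[" h ", " Y "]" => (𝐉[Δ[𝐮₁] h, Y] + 𝐉[Δ[𝐮₂] h, Y] + 𝐉[Δ[𝐰₃] h, Y])

/-- **The linear decay step** (see the module docstring). [folklore] -/
theorem linear_decay (hA : Adm₀ A) (hI : Inner₀ t A) (hκ0 : 0 < κ)
    (hκ : ∀ v : (EuclideanSpace ℝ (Fin 3)) → (EuclideanSpace ℝ (Fin 3)), (Function.support v).Finite →
      Function.support v ⊆ Sites₀ t A → κ * nnForm t A v ≤ ∑' p : Sites₀ t A, ⟪𝕃 v @ p, v p⟫)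
    {h : (EuclideanSpace ℝ (Fin 3)) → (EuclideanSpace ℝ (Fin 3))} (hh : (Function.support h).Finite)
    {r' : ℝ} (hr' : 2 ≤ r') {ρh : ℝ} (hρh : 2 * (1280 * r' + 2388) + 4 ≤ ρh)
    {Gf : (EuclideanSpace ℝ (Fin 3)) → (EuclideanSpace ℝ (Fin 3))}
    (hG : ∀ (p : Sites₀ t A) (l : EuclideanSpace ℝ (Fin 3)), l ∈ Λ₀ → Gf ((p : EuclideanSpace ℝ (Fin 3)) + A l) = Gf p)
    (hrows : ∀ p : Sites₀ t A, dist (p : EuclideanSpace ℝ (Fin 3)) c₀ ≤ ρh → 𝕃 h @ p = Gf p)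
    (hwork : 𝐖[Gf, h, 1280 * r' + 2388] ≤ 0) :
    ∃ z₀ : EuclideanSpace ℝ (Fin 3), z₀ ∈ Λ₀ ∧ dist (t 0 + A z₀) c₀ ≤ 11 / 10 ∧
      ∃ (a : Fin 2 → EuclideanSpace ℝ (Fin 3)) (B : EuclideanSpace ℝ (Fin 3) →L[ℝ] EuclideanSpace ℝ (Fin 3)),
      ‖B‖ ^ 2 ≤ 144 * (64 * 𝐋 ^ 3 / r' ^ 3 *
          (𝐋 * (𝐌[h, 4 * (1280 * r' + 2388) + 4] / (1280 * r' + 2388) ^ 2 + 𝐉[h, 10 * r' + 10])) +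
          536 * 𝐋 ^ 3 * r' ^ 3 * 𝐉Δ[h, 10 * r' + 10]) ∧
      a 0 = h (t 0 + A z₀) ∧ a 1 = h (t 1 + A z₀) - B (t 1 - t 0) ∧
      ∀ (r : ℝ) (N : ℕ), 400 / 189 * (r + 11 / 5) ≤ N → 4 * (N : ℝ) + 11 ≤ r' →
      ∀ (m : Fin 2) (z : EuclideanSpace ℝ (Fin 3)), z ∈ Λ₀ → dist (t m + A z) c₀ ≤ r →
        ‖h (t m + A z) - (a m + B (t m + A z - (t 0 + A z₀)))‖ ^ 2 ≤
          144 * (N : ℝ) ^ 4 * (64 * 𝐋 ^ 4 / r' ^ 5 *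
            (𝐋 * (𝐌[h, 4 * (1280 * r' + 2388) + 4] / (1280 * r' + 2388) ^ 2 + 𝐉[h, 10 * r' + 10])) +
            (64 * 𝐋 ^ 4 / r' ^ 3 + 3216 * 𝐋 ^ 4 * r' ^ 3) * 𝐉Δ[h, 10 * r' + 10]) := by
  obtain ⟨z₀, hz₀, hp₀⟩ := exists_site_dist_le hA t 0 c₀
  refine ⟨z₀, hz₀, hp₀, ?_⟩
  have hr0 : 0 < r' := by linarith
  have hY0 : (0 : ℝ) < 10 * r' + 10 := by linarith
  obtain ⟨hL1, -, -, -⟩ := levelConst_le (κ := κ) hκ0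
  have hL0 : 0 ≤ 𝐋 := by linarith
  have hM0 : 0 ≤ 𝐌[h, 4 * (1280 * r' + 2388) + 4] := mass_nonneg h _
  have hJ0 : 0 ≤ 𝐉[h, 10 * r' + 10] := farMass_nonneg h _ hY0
  have hJ1 : 0 ≤ 𝐉[Δ[𝐮₁] h, 10 * r' + 10] := farMass_nonneg (Δ[𝐮₁] h) _ hY0
  have hJ2 : 0 ≤ 𝐉[Δ[𝐮₂] h, 10 * r' + 10] := farMass_nonneg (Δ[𝐮₂] h) _ hY0
  have hJ3 : 0 ≤ 𝐉[Δ[𝐰₃] h, 10 * r' + 10] := farMass_nonneg (Δ[𝐰₃] h) _ hY0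
  generalize hΓ : 𝐋 * (𝐌[h, 4 * (1280 * r' + 2388) + 4] / (1280 * r' + 2388) ^ 2 + 𝐉[h, 10 * r' + 10]) = Γ
  generalize hJD : 𝐉Δ[h, 10 * r' + 10] = JD
  have hΓ0 : 0 ≤ Γ := by rw [← hΓ]; positivity
  have hJD0 : 0 ≤ JD := by rw [← hJD]; positivity
  -- the two pointwise bounds, packaged
  have hΘ1 : 0 ≤ 64 * 𝐋 ^ 3 / r' ^ 3 * Γ + 536 * 𝐋 ^ 3 * r' ^ 3 * JD := by positivity
  have hΘ2 : 0 ≤ 64 * 𝐋 ^ 4 / r' ^ 5 * Γ + (64 * 𝐋 ^ 4 / r' ^ 3 + 3216 * 𝐋 ^ 4 * r' ^ 3) * JD := by positivity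
  have hgrad : ∀ {τ : EuclideanSpace ℝ (Fin 3)}, (τ = 𝐮₁ ∨ τ = 𝐮₂ ∨ τ = 𝐰₃) →
      ‖(Δ[τ] h) (t 0 + A z₀)‖ ^ 2 ≤ 64 * 𝐋 ^ 3 / r' ^ 3 * Γ + 536 * 𝐋 ^ 3 * r' ^ 3 * JD := by
    intro τ hτ
    have := sup_grad_sq_le hA hI hκ0 hκ hh hr' (ρh := ρh) (by linarith) hG hrows hwork hτ
      (x₀ := t 0 + A z₀) ⟨0, z₀, hz₀, rfl⟩ (by linarith)
    rw [hΓ, hJD] at this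
    exact this
  have hhess : ∀ x ∈ Sites₀ t A, dist x c₀ ≤ r' → ∀ σ τ : EuclideanSpace ℝ (Fin 3),
      (σ = 𝐮₁ ∨ σ = 𝐮₂ ∨ σ = 𝐰₃) → (τ = 𝐮₁ ∨ τ = 𝐮₂ ∨ τ = 𝐰₃) →
      ‖(Δ[σ] (Δ[τ] h)) x‖ ^ 2 ≤ 64 * 𝐋 ^ 4 / r' ^ 5 * Γ + (64 * 𝐋 ^ 4 / r' ^ 3 + 3216 * 𝐋 ^ 4 * r' ^ 3) * JD := by
    intro x hx hxr σ τ hσ hτ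
    have := sup_hess_sq_le hA hI hκ0 hκ hh hr' hρh hG hrows hwork hσ hτ hx hxr
    rw [hΓ, hJD] at this
    exact this
  have hcross : ∀ τ : EuclideanSpace ℝ (Fin 3), (τ = 𝐮₁ ∨ τ = 𝐮₂ ∨ τ = 𝐰₃) →
      ‖(Δ[τ] h) (t 0 + A z₀) - (Δ[τ] h) (t 0 + A z₀ + (t 1 - t 0))‖ ^ 2 ≤
        64 * 𝐋 ^ 4 / r' ^ 5 * Γ + (64 * 𝐋 ^ 4 / r' ^ 3 + 3216 * 𝐋 ^ 4 * r' ^ 3) * JD := by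
    intro τ hτ
    have := sup_cross_sq_le hA hI hκ0 hκ hh hr' (ρh := ρh) (by linarith) hG hrows hwork hτ (x₀ := t 0 + A z₀)
      ⟨z₀, hz₀, rfl⟩ (by linarith)
    rw [hΓ, hJD] at this
    exact this
  obtain ⟨a, B, hBn, ha0, ha1, happrox⟩ := taylor_affine_approx hA hI hΘ2 hz₀ hp₀ hhess hcross
  refine ⟨a, B, ?_, ha0, ha1, fun r N hN hr'N m z hz hq => ?_⟩
  · -- the slope
    have hS := Real.sqrt_nonneg (64 * 𝐋 ^ 3 / r' ^ 3 * Γ + 536 * 𝐋 ^ 3 * r' ^ 3 * JD)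
    have hd : ∀ {τ : EuclideanSpace ℝ (Fin 3)}, (τ = 𝐮₁ ∨ τ = 𝐮₂ ∨ τ = 𝐰₃) →
        ‖(Δ[τ] h) (t 0 + A z₀)‖ ≤ Real.sqrt (64 * 𝐋 ^ 3 / r' ^ 3 * Γ + 536 * 𝐋 ^ 3 * r' ^ 3 * JD) := fun hτ =>
      (Real.le_sqrt (norm_nonneg _) hΘ1).2 (hgrad hτ)
    have h1 := hd (Or.inl rfl : (𝐮₁ : EuclideanSpace ℝ (Fin 3)) = 𝐮₁ ∨ 𝐮₁ = 𝐮₂ ∨ 𝐮₁ = 𝐰₃)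
    have h2 := hd (Or.inr (Or.inl rfl) : (𝐮₂ : EuclideanSpace ℝ (Fin 3)) = 𝐮₁ ∨ 𝐮₂ = 𝐮₂ ∨ 𝐮₂ = 𝐰₃)
    have h3 := hd (Or.inr (Or.inr rfl) : (𝐰₃ : EuclideanSpace ℝ (Fin 3)) = 𝐮₁ ∨ 𝐰₃ = 𝐮₂ ∨ 𝐰₃ = 𝐰₃)
    have hB12 : ‖B‖ ≤ 12 * Real.sqrt (64 * 𝐋 ^ 3 / r' ^ 3 * Γ + 536 * 𝐋 ^ 3 * r' ^ 3 * JD) := by linarith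
    have := pow_le_pow_left₀ (norm_nonneg _) hB12 2
    rw [mul_pow, Real.sq_sqrt hΘ1] at this
    linarith
  · -- the approximation, squared
    have h1 := happrox r N hN hr'N m z hz hq
    have hS := Real.sqrt_nonneg (64 * 𝐋 ^ 4 / r' ^ 5 * Γ + (64 * 𝐋 ^ 4 / r' ^ 3 + 3216 * 𝐋 ^ 4 * r' ^ 3) * JD)
    have := pow_le_pow_left₀ (norm_nonneg _) h1 2
    rw [mul_pow, mul_pow, Real.sq_sqrt hΘ2] at this
    have e : (12 : ℝ) ^ 2 * ((N : ℝ) ^ 2) ^ 2 = 144 * (N : ℝ) ^ 4 := by ring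
    rw [e] at this
    exact this

end

end Summit.AtomisticToContinuum.Crystallization.Theorems.ExcessDecayLiouville

end
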